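import Literature.Barriers.QuantumAdvantage.UncorrectedNoiseMachineTuples
import Mathlib.Data.List.Sort
import HarnessLib

/-!
# The noisy-IQP simulating machine, II: canonical tuples code the small subsets bijectively

Support file for the discharge of `bremnerMontanaroShepherd2017_thm4`
(`Literature/Barriers/QuantumAdvantage/UncorrectedNoise.lean`). The machine of
`UncorrectedNoiseMachineTuples.lean` enumerates the subsets `S ⊆ [N]`, `|S| ≤ ℓ` (the supports
of the stored Fourier coefficients of Bremner–Montanaro–Shepherd 2017, §3.1) as the *canonical*
base-`(N+1)` digit tuples of the counters `c < (N+1)^ℓ`. This file is the combinatorics linking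
the two descriptions (pure mathematics about `baseDigits`, `IsCanon`):

* `tupleSet N l` — the subset coded by a tuple; the structure of canonical tuples
  (`IsCanon.decomp`: strictly increasing non-blank part, then blanks);
* the dictionary used to read the machine's folds as statements about `S`:
  `card_tupleSet` (`|S|`), `countP_marked_eq_card` (`χ_S(y)`), `mem_tupleSet_iff` (`s_i`),
  `forall_lt_or_blank_iff` (`S ⊆ [K]`);
* the inverse coding `setTuple` and the round trips `tupleSet_setTuple`, `setTuple_tupleSet`;
  base-`K` digits as a bijection (`ofDigits_baseDigits`, `baseDigits_ofDigits`);
* **`sum_canonical_eq_sum_subsets`**: `Σ_{c < (N+1)^ℓ, canonical} f(S(c)) = Σ_{|S| ≤ ℓ} f(S)`.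

## References

* [BremnerMontanaroShepherd2017] M. J. Bremner, A. Montanaro, D. J. Shepherd, *Achieving quantum
  supremacy with sparse and noisy commuting quantum computations*, Quantum 1 (2017) 8, §3.1.
-/

namespace Literature.Barriers.QuantumAdvantage.NoisyIQPMachine

open Finset

/-! ### The subset coded by a tuple, and the structure of canonical tuples -/

/-- The set of positions `< N` occurring in a tuple (blanks `N` and anything larger are
ignored). [folklore] -/
def tupleSet (N : ℕ) (l : List ℕ) : Finset (Fin N) := univ.filter fun i => (i : ℕ) ∈ l

/-- Membership in `tupleSet`. [folklore] -/
@[simp] theorem mem_tupleSet {N : ℕ} {l : List ℕ} {i : Fin N} : i ∈ tupleSet N l ↔ (i : ℕ) ∈ l := by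
  simp [tupleSet]

/-- The tail of a canonical tuple is canonical. [folklore] -/
theorem IsCanon.tail {N p : ℕ} {rest : List ℕ} (h : IsCanon N (p :: rest)) : IsCanon N rest :=
  (List.isChain_cons.1 h).2

/-- The relation between the first two entries of a canonical tuple. [folklore] -/
theorem IsCanon.rel {N p q : ℕ} {rest : List ℕ} (h : IsCanon N (p :: q :: rest)) : CanonRel N p q :=
  (List.isChain_cons_cons.1 h).1

/-- After a blank, a canonical tuple is all blanks. [folklore] -/
theorem IsCanon.all_blank {N : ℕ} : ∀ {rest : List ℕ}, IsCanon N (N :: rest) → (∀ q ∈ rest, q ≤ N) → ∀ q ∈ rest, q = N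
  | [], _, _, q, hq => by simp at hq
  | r :: rest, h, hle, q, hq => by
    have hr : r = N := by
      rcases h.rel with h1 | h1
      · exact absurd h1 (not_lt.2 (hle r (by simp)))
      · exact h1
    subst hr
    rcases List.mem_cons.1 hq with rfl | hq
    · rfl
    · exact IsCanon.all_blank h.tail (fun q' hq' => hle q' (by simp [hq'])) q hq

/-- In a canonical tuple, a non-blank first entry is below every later non-blank entry. [folklore] -/
theorem IsCanon.head_lt {N : ℕ} : ∀ {p : ℕ} {rest : List ℕ}, IsCanon N (p :: rest) → p < N →
    (∀ q ∈ rest, q ≤ N) → ∀ q ∈ rest, q < N → p < q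
  | p, [], _, _, _, q, hq, _ => by simp at hq
  | p, r :: rest, h, hp, hle, q, hq, hqN => by
    rcases h.rel with h1 | h1
    · -- `p < r`
      rcases List.mem_cons.1 hq with rfl | hq'
      · exact h1
      · rcases (hle r (by simp)).lt_or_eq with hr | hr
        · exact h1.trans (IsCanon.head_lt h.tail hr (fun q' hq' => hle q' (by simp [hq'])) q hq' hqN)
        · subst hr
          exact absurd (IsCanon.all_blank h.tail (fun q' hq' => hle q' (by simp [hq'])) q hq') hqN.ne
    · -- `r = N`: everything after is blank
      subst h1
      rcases List.mem_cons.1 hq with rfl | hq'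
      · exact absurd rfl hqN.ne
      · exact absurd (IsCanon.all_blank h.tail (fun q' hq' => hle q' (by simp [hq'])) q hq') hqN.ne

/-- The non-blank part of a tuple. [folklore] -/
def nonBlank (N : ℕ) (l : List ℕ) : List ℕ := l.filter fun q => q < N

/-- **Structure of canonical tuples**: the non-blank entries are strictly increasing and the
tuple is the non-blank part followed by blanks. [folklore] -/
theorem IsCanon.decomp {N : ℕ} : ∀ {l : List ℕ}, IsCanon N l → (∀ q ∈ l, q ≤ N) →
    (nonBlank N l).Pairwise (· < ·) ∧ l = nonBlank N l ++ List.replicate (l.length - (nonBlank N l).length) N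
  | [], _, _ => by simp [nonBlank]
  | p :: rest, h, hle => by
    have hrest : ∀ q ∈ rest, q ≤ N := fun q hq => hle q (by simp [hq])
    obtain ⟨ih1, ih2⟩ := IsCanon.decomp h.tail hrest
    rcases (hle p (by simp)).lt_or_eq with hp | hp
    · -- non-blank head
      have hnb : nonBlank N (p :: rest) = p :: nonBlank N rest := by simp [nonBlank, hp]
      rw [hnb]
      refine ⟨List.pairwise_cons.2 ⟨fun q hq => ?_, ih1⟩, ?_⟩
      · simp only [nonBlank, List.mem_filter, decide_eq_true_eq] at hq
        exact IsCanon.head_lt h hp hrest q hq.1 hq.2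
      · conv_lhs => rw [ih2]
        simp
    · -- blank head: all blank
      subst hp
      have hall := IsCanon.all_blank h hrest
      have hnb : nonBlank p (p :: rest) = [] := by
        simp only [nonBlank, List.filter_eq_nil_iff, decide_eq_true_eq, List.mem_cons]
        rintro q (rfl | hq)
        · exact lt_irrefl _
        · rw [hall q hq]; exact lt_irrefl _
      rw [hnb]
      refine ⟨List.Pairwise.nil, ?_⟩
      simp only [List.nil_append, List.length_cons, List.length_nil, Nat.sub_zero]
      rw [List.eq_replicate_iff]
      refine ⟨by simp, fun q hq => ?_⟩
      rcases List.mem_cons.1 hq with rfl | hq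
      · rfl
      · exact hall q hq

/-- Membership in the non-blank part. [folklore] -/
theorem mem_nonBlank {N : ℕ} {l : List ℕ} {q : ℕ} : q ∈ nonBlank N l ↔ q ∈ l ∧ q < N := by
  simp [nonBlank]

/-- The coded subset, read on `ℕ`, is the set of non-blank entries. [folklore] -/
theorem map_tupleSet (N : ℕ) (l : List ℕ) : (tupleSet N l).map Fin.valEmbedding = (nonBlank N l).toFinset := by
  ext q
  simp only [Finset.mem_map, mem_tupleSet, Fin.valEmbedding_apply, List.mem_toFinset, mem_nonBlank]
  constructor
  · rintro ⟨i, hi, rfl⟩; exact ⟨hi, i.2⟩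
  · rintro ⟨hq, hqN⟩; exact ⟨⟨q, hqN⟩, hq, rfl⟩

/-- **`|S|` from the tuple**: for a canonical tuple the coded subset has as many elements as
there are non-blank entries. [folklore] -/
theorem card_tupleSet {N : ℕ} {l : List ℕ} (h : IsCanon N l) (hle : ∀ q ∈ l, q ≤ N) :
    (tupleSet N l).card = (nonBlank N l).length := by
  rw [← Finset.card_map Fin.valEmbedding, map_tupleSet,
    List.toFinset_card_of_nodup ((IsCanon.decomp h hle).1.nodup)]

/-- `countP (· ≠ N)` counts the non-blank entries (entries `≤ N`). [folklore] -/
theorem countP_ne_eq_length_nonBlank {N : ℕ} {l : List ℕ} (hle : ∀ q ∈ l, q ≤ N) :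
    l.countP (fun q => q ≠ N) = (nonBlank N l).length := by
  rw [nonBlank, List.countP_eq_length_filter]
  congr 1
  refine List.filter_congr fun q hq => ?_
  rcases (hle q hq).lt_or_eq with h | h
  · simp [h, h.ne]
  · simp [h]

/-- **`χ_S(y)` from the tuple**: for a canonical tuple and a string `y` of length `≤ N`, the
number of entries `p` with `y[p] = 1` is the number of elements `i ∈ S` with `y[i] = 1` (blanks
read `0`, non-blank entries are distinct). [folklore] -/
theorem countP_marked_eq_card {N : ℕ} {l : List ℕ} (h : IsCanon N l) (hle : ∀ q ∈ l, q ≤ N)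
    (y : List Bool) (hy : y.length ≤ N) :
    l.countP (fun q => y.getD q false = true) = ((tupleSet N l).filter fun i : Fin N => y.getD i.val false = true).card := by
  -- entries beyond `|y|` never count, so only non-blank entries matter
  have h1 : l.countP (fun q => y.getD q false = true) = (nonBlank N l).countP (fun q => y.getD q false = true) := by
    rw [nonBlank, List.countP_filter]
    refine List.countP_congr fun q _ => ?_
    simp only [Bool.and_eq_true, decide_eq_true_eq]
    constructor
    · intro hm
      refine ⟨hm, ?_⟩
      by_contra hc
      rw [List.getD_eq_default _ _ (by omega)] at hm
      exact Bool.false_ne_true hm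
    · exact fun hm => hm.1
  have h2 : ((tupleSet N l).map Fin.valEmbedding).filter (fun q => y.getD q false = true) =
      ((tupleSet N l).filter fun i : Fin N => y.getD i.val false = true).map Fin.valEmbedding :=
    Finset.filter_map
  rw [h1, ← Finset.card_map Fin.valEmbedding, ← h2, map_tupleSet, List.countP_eq_length_filter,
    ← List.toFinset_card_of_nodup (((IsCanon.decomp h hle).1.nodup).filter _), List.toFinset_filter]
  congr 1
  ext q
  simp

/-- **`s_i` from the tuple**: membership of a position `i < N`. [folklore] -/
theorem mem_tupleSet_iff {N i : ℕ} (hi : i < N) (l : List ℕ) : (⟨i, hi⟩ : Fin N) ∈ tupleSet N l ↔ i ∈ l :=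
  mem_tupleSet

/-- **`S ⊆ {0,…,K−1}` from the tuple** (entries `≤ N`). [folklore] -/
theorem forall_lt_or_blank_iff {N K : ℕ} {l : List ℕ} (hle : ∀ q ∈ l, q ≤ N) :
    (∀ p ∈ l, p < K ∨ p = N) ↔ ∀ i ∈ tupleSet N l, (i : ℕ) < K := by
  constructor
  · intro hl i hi
    rw [mem_tupleSet] at hi
    rcases hl i hi with h' | h'
    · exact h'
    · exact absurd h' (ne_of_lt i.2)
  · intro hs p hp
    rcases (hle p hp).lt_or_eq with h' | h'
    · exact Or.inl (hs ⟨p, h'⟩ (mem_tupleSet.2 hp))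
    · exact Or.inr h'

/-! ### The canonical tuple of a subset -/

/-- The increasing list of the elements of `S` (as naturals). [folklore] -/
def sortedList {N : ℕ} (S : Finset (Fin N)) : List ℕ := (List.range N).filter fun q => ∃ h : q < N, (⟨q, h⟩ : Fin N) ∈ S

/-- Membership in `sortedList`. [folklore] -/
theorem mem_sortedList {N : ℕ} {S : Finset (Fin N)} {q : ℕ} : q ∈ sortedList S ↔ ∃ h : q < N, (⟨q, h⟩ : Fin N) ∈ S := by
  simp only [sortedList, List.mem_filter, List.mem_range, decide_eq_true_eq]
  constructor
  · rintro ⟨_, h⟩; exact h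
  · rintro ⟨h, hS⟩; exact ⟨h, h, hS⟩

/-- `sortedList` is strictly increasing. [folklore] -/
theorem pairwise_sortedList {N : ℕ} (S : Finset (Fin N)) : (sortedList S).Pairwise (· < ·) :=
  List.Pairwise.filter _ List.pairwise_lt_range

/-- `sortedList S` enumerates `S`. [folklore] -/
theorem toFinset_sortedList {N : ℕ} (S : Finset (Fin N)) : (sortedList S).toFinset = S.map Fin.valEmbedding := by
  ext q
  simp only [List.mem_toFinset, mem_sortedList, Finset.mem_map, Fin.valEmbedding_apply]
  constructor
  · rintro ⟨h, hS⟩; exact ⟨⟨q, h⟩, hS, rfl⟩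
  · rintro ⟨i, hi, rfl⟩; exact ⟨i.2, hi⟩

/-- `|sortedList S| = |S|`. [folklore] -/
theorem length_sortedList {N : ℕ} (S : Finset (Fin N)) : (sortedList S).length = S.card := by
  rw [← List.toFinset_card_of_nodup (pairwise_sortedList S).nodup, toFinset_sortedList, Finset.card_map]

/-- **The canonical tuple of a subset**: its sorted elements, padded with blanks to length `ℓ`.
[folklore] -/
def setTuple (N ℓ : ℕ) (S : Finset (Fin N)) : List ℕ := sortedList S ++ List.replicate (ℓ - S.card) N

/-- Entries of `setTuple` are `≤ N`. [folklore] -/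
theorem le_of_mem_setTuple {N ℓ : ℕ} {S : Finset (Fin N)} {q : ℕ} (hq : q ∈ setTuple N ℓ S) : q ≤ N := by
  simp only [setTuple, List.mem_append, mem_sortedList, List.mem_replicate] at hq
  rcases hq with ⟨h, _⟩ | ⟨_, rfl⟩
  · exact h.le
  · exact le_rfl

/-- Entries of `setTuple` are `< N + 1`. [folklore] -/
theorem lt_succ_of_mem_setTuple {N ℓ : ℕ} {S : Finset (Fin N)} {q : ℕ} (hq : q ∈ setTuple N ℓ S) : q < N + 1 :=
  Nat.lt_succ_of_le (le_of_mem_setTuple hq)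

/-- `setTuple` has length `ℓ` when `|S| ≤ ℓ`. [folklore] -/
theorem length_setTuple {N ℓ : ℕ} {S : Finset (Fin N)} (hS : S.card ≤ ℓ) : (setTuple N ℓ S).length = ℓ := by
  rw [setTuple, List.length_append, length_sortedList, List.length_replicate]; omega

/-- `setTuple` codes `S`. [folklore] -/
theorem tupleSet_setTuple (N ℓ : ℕ) (S : Finset (Fin N)) : tupleSet N (setTuple N ℓ S) = S := by
  ext i
  rw [mem_tupleSet, setTuple, List.mem_append, mem_sortedList, List.mem_replicate]
  constructor
  · rintro (⟨h, hS⟩ | ⟨_, h⟩)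
    · exact hS
    · exact absurd h (ne_of_lt i.2)
  · intro hi; exact Or.inl ⟨i.2, hi⟩

/-- `setTuple` is canonical. [folklore] -/
theorem isCanon_setTuple (N ℓ : ℕ) (S : Finset (Fin N)) : IsCanon N (setTuple N ℓ S) := by
  rw [IsCanon, setTuple, List.isChain_append]
  refine ⟨?_, ?_, ?_⟩
  · exact (List.isChain_iff_pairwise.2 (pairwise_sortedList S)).imp fun a b h => Or.inl h
  · induction (ℓ - S.card) with
    | zero => exact List.IsChain.nil
    | succ k ih =>
      rw [List.replicate_succ, List.isChain_cons]
      refine ⟨fun y hy => Or.inr ?_, ih⟩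
      cases k with
      | zero => simp at hy
      | succ k => simp [List.replicate_succ] at hy; exact hy.symm
  · intro x _ y hy
    right
    cases h : ℓ - S.card with
    | zero => rw [h] at hy; simp at hy
    | succ k => rw [h, List.replicate_succ] at hy; simp at hy; exact hy.symm

/-- **Round trip**: the canonical tuple of the subset coded by a canonical tuple of length `ℓ`
is the tuple itself. [folklore] -/
theorem setTuple_tupleSet {N ℓ : ℕ} {l : List ℕ} (h : IsCanon N l) (hle : ∀ q ∈ l, q ≤ N) (hl : l.length = ℓ) :
    setTuple N ℓ (tupleSet N l) = l := by
  obtain ⟨hpw, hdec⟩ := IsCanon.decomp h hle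
  have hsorted : sortedList (tupleSet N l) = nonBlank N l := by
    apply List.Subset.antisymm_of_pairwise (pairwise_sortedList _) hpw
    · intro q hq
      rw [mem_sortedList] at hq
      obtain ⟨hqN, hq⟩ := hq
      rw [mem_tupleSet] at hq
      exact mem_nonBlank.2 ⟨hq, hqN⟩
    · intro q hq
      rw [mem_nonBlank] at hq
      exact mem_sortedList.2 ⟨hq.2, mem_tupleSet.2 hq.1⟩
  rw [setTuple, hsorted, card_tupleSet h hle, ← hl]
  exact hdec.symm

/-! ### Base-`K` digits as a bijection -/

/-- `ofDigits` inverts `baseDigits` below `K^ℓ`. [folklore] -/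
theorem ofDigits_baseDigits {K : ℕ} (hK : 0 < K) : ∀ (ℓ c : ℕ), c < K ^ ℓ → Nat.ofDigits K (baseDigits K ℓ c) = c
  | 0, c, hc => by simp [baseDigits] at hc ⊢; omega
  | ℓ + 1, c, hc => by
    rw [baseDigits, Nat.ofDigits_cons, ofDigits_baseDigits hK ℓ (c / K)
      ((Nat.div_lt_iff_lt_mul hK).2 (by rw [pow_succ] at hc; exact hc))]
    exact Nat.mod_add_div c K

/-- `baseDigits` inverts `ofDigits` on digit lists of length `ℓ`. [folklore] -/
theorem baseDigits_ofDigits (K : ℕ) : ∀ (ℓ : ℕ) (l : List ℕ), l.length = ℓ → (∀ d ∈ l, d < K) →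
    baseDigits K ℓ (Nat.ofDigits K l) = l
  | 0, l, hl, _ => by rw [List.length_eq_zero_iff] at hl; subst hl; rfl
  | ℓ + 1, l, hl, hd => by
    match l, hl with
    | d :: t, hl =>
      have hdK : d < K := hd d (by simp)
      have hK : 0 < K := lt_of_le_of_lt (Nat.zero_le d) hdK
      simp only [List.length_cons, Nat.add_right_cancel_iff] at hl
      rw [Nat.ofDigits_cons, baseDigits]
      congr 1
      · rw [Nat.add_mul_mod_self_left, Nat.mod_eq_of_lt hdK]
      · rw [Nat.add_mul_div_left _ _ hK, Nat.div_eq_of_lt hdK, zero_add]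
        exact baseDigits_ofDigits K ℓ t hl (fun d' hd' => hd d' (by simp [hd']))

/-- Digit lists with digits `< K` code numbers `< K^length`. [folklore] -/
theorem ofDigits_lt_pow {K : ℕ} : ∀ (l : List ℕ), (∀ d ∈ l, d < K) → Nat.ofDigits K l < K ^ l.length
  | [], _ => by simp
  | d :: t, hd => by
    have hdK : d < K := hd d (by simp)
    have ih := ofDigits_lt_pow t (fun d' hd' => hd d' (by simp [hd']))
    rw [Nat.ofDigits_cons, List.length_cons, pow_succ]
    calc d + K * Nat.ofDigits K t ≤ (K - 1) + K * (K ^ t.length - 1) := by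
          have := Nat.mul_le_mul_left K (Nat.le_sub_one_of_lt ih); omega
      _ < K ^ t.length * K := by
          have h1 : 1 ≤ K ^ t.length := Nat.one_le_pow _ _ (by omega)
          rw [Nat.mul_sub_one, mul_comm]
          have : K ≤ K ^ t.length * K := Nat.le_mul_of_pos_left K (by omega)
          omega

/-- Entries of `baseDigits (N+1)` are `≤ N`. [folklore] -/
theorem le_of_mem_baseDigits_succ {N ℓ c q : ℕ} (hq : q ∈ baseDigits (N + 1) ℓ c) : q ≤ N :=
  Nat.lt_succ_iff.1 (lt_of_mem_baseDigits (Nat.succ_pos N) hq)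

/-! ### Summing over canonical counters = summing over small subsets -/

/-- **Reindexing the machine's enumeration**: summing a function of the coded subset over the
counters `c < (N+1)^ℓ` whose digit tuple is canonical is summing it over all subsets of `[N]`
with at most `ℓ` elements — each such subset being coded by exactly one canonical tuple.
[cite: BremnerMontanaroShepherd2017, §3.1 ("|{s : |s| ≤ ℓ}| = Σ_{k ≤ ℓ} binom(n,k) ≤ n^ℓ + 1")] -/
theorem sum_canonical_eq_sum_subsets {M : Type*} [AddCommMonoid M] (N ℓ : ℕ) (f : Finset (Fin N) → M) :
    ∑ c ∈ Finset.range ((N + 1) ^ ℓ),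
        (if IsCanon N (baseDigits (N + 1) ℓ c) then f (tupleSet N (baseDigits (N + 1) ℓ c)) else 0) =
      ∑ S ∈ univ.filter (fun S : Finset (Fin N) => S.card ≤ ℓ), f S := by
  rw [← Finset.sum_filter]
  refine Finset.sum_nbij' (fun c => tupleSet N (baseDigits (N + 1) ℓ c))
    (fun S => Nat.ofDigits (N + 1) (setTuple N ℓ S)) ?_ ?_ ?_ ?_ (fun _ _ => rfl)
  · intro c hc
    simp only [Finset.mem_filter, Finset.mem_range] at hc
    simp only [Finset.mem_filter, Finset.mem_univ, true_and]
    rw [card_tupleSet hc.2 (fun q hq => le_of_mem_baseDigits_succ hq)]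
    exact (List.length_filter_le _ _).trans (length_baseDigits _ _ _).le
  · intro S hS
    simp only [Finset.mem_filter, Finset.mem_univ, true_and] at hS
    simp only [Finset.mem_filter, Finset.mem_range]
    have hlt := ofDigits_lt_pow (K := N + 1) (setTuple N ℓ S) (fun d hd => lt_succ_of_mem_setTuple hd)
    rw [length_setTuple hS] at hlt
    refine ⟨hlt, ?_⟩
    rw [baseDigits_ofDigits (N + 1) ℓ _ (length_setTuple hS) (fun d hd => lt_succ_of_mem_setTuple hd)]
    exact isCanon_setTuple N ℓ S
  · intro c hc
    simp only [Finset.mem_filter, Finset.mem_range] at hc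
    show Nat.ofDigits (N + 1) (setTuple N ℓ (tupleSet N (baseDigits (N + 1) ℓ c))) = c
    rw [setTuple_tupleSet hc.2 (fun q hq => le_of_mem_baseDigits_succ hq) (length_baseDigits _ _ _),
      ofDigits_baseDigits (Nat.succ_pos N) ℓ c hc.1]
  · intro S hS
    simp only [Finset.mem_filter, Finset.mem_univ, true_and] at hS
    show tupleSet N (baseDigits (N + 1) ℓ (Nat.ofDigits (N + 1) (setTuple N ℓ S))) = S
    rw [baseDigits_ofDigits (N + 1) ℓ _ (length_setTuple hS) (fun d hd => lt_succ_of_mem_setTuple hd),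
      tupleSet_setTuple]

end Literature.Barriers.QuantumAdvantage.NoisyIQPMachine
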